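import Summits.ValiantsHypothesis.ValiantsHypothesis.Theorems.DivisionGapPerDivisionHardStubOrderedCut
import Summits.ValiantsHypothesis.ValiantsHypothesis.Theorems.DivisionGapPerDivisionHardStubKeyRigid

/-!
# Crux `DivisionGap.PerDivisionHard` (stmt-ValiantsHypothesis-5065), line `pair-descent-jss-endpoint` —
stub `stub_isolationRigid` (skeleton v15.2, the lead's stub): K2 for cofactors with an ISOLATED monomial

`m* ∈ supp h` is ISOLATED by the cells `e 0, …, e (t-1)` if every other monomial of `h` is
lexicographically larger along that list (the iterated coordinate-argmin over the list ends in
`{m*}`).  If all monomials of `h ≠ 0` have one degree and some monomial is isolated by `t` cells with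
`4t ≤ n`, then the placement of the block arsenal `G(b,1) ⊕ M₀` with its face OFF those cells
(`stub_keyPlacement`, `b = (log₂ n + d)^d`) and the ORDERED generic cut giving them the top ranks
(`stub_orderedCut`: the top fibre is lexicographically ≤ every monomial of `h` along the list) have
the one-monomial top fibre `{m*}` — a single `G`-part.  No torus homogeneity is needed; this is the
statement-level form of the "magnet" phenomenon of dossier v8 (digit ORDER decides the fibre).
-/

noncomputable section

-- `Summit.ValiantsHypothesis.ValiantsHypothesis.…` is the tree's mandated single-conjunct layout
-- (Sub = Summit), so the duplicated namespace component is intended.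
set_option linter.dupNamespace false

namespace Summit.ValiantsHypothesis.ValiantsHypothesis.Theorems.DivisionGapPerDivisionHard

open MvPolynomial Literature.Computability.AlgebraicComplexity
open Summit.ValiantsHypothesis.ValiantsHypothesis.Theorems.ZeroOneTransfer.Negative
  (topComponent support_topComponent_subset topComponent_ne_zero)
open scoped NNReal

/-- **`stub_isolationRigid` (K2 of line `pair-descent-jss-endpoint` for cofactors with an ISOLATED
monomial; skeleton v15.2, the lead's stub).**  For every `d` there is `n₀` such that for `n ≥ n₀`:
if all monomials of `h ≠ 0` have one degree and `ms ∈ supp h` is the strict lexicographic minimum of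
`supp h` along an injective list `e` of `t` cells with `4t ≤ n`, then some placement `eR eC` of
`G(b,1) ⊕ M₀` with `b = (log₂ n + d)^d` (face off the cells `e i`, `stub_keyPlacement`), the ordered
cut `w` (`stub_orderedCut`) and some `u` satisfy `CutsOut w (placedBlock eR eC)` and
`HasSingleGPart (placedBlock eR eC) w h u`. [folklore] -/
theorem stub_isolationRigid :
    ∀ d : ℕ, ∃ n₀ : ℕ, ∀ n ≥ n₀, ∀ h : MvPolynomial (Fin n × Fin n) ℝ≥0, h ≠ 0 →
      (∀ m₁ ∈ h.support, ∀ m₂ ∈ h.support, m₁.degree = m₂.degree) →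
      ∀ (t : ℕ) (e : Fin t → Fin n × Fin n), Function.Injective e → 4 * t ≤ n →
      ∀ ms ∈ h.support,
      (∀ m' ∈ h.support, m' ≠ ms →
        ∃ i : Fin t, (∀ j : Fin t, j < i → m' (e j) = ms (e j)) ∧ ms (e i) < m' (e i)) →
      ∃ (b k m : ℕ) (eR eC : BlockV b k m ≃ Fin n) (w : Fin n × Fin n → ℕ)
        (u : (Fin n × Fin n) →₀ ℕ),
        (Nat.log 2 n + d) ^ d ≤ b ∧ CutsOut w (placedBlock eR eC) ∧
          HasSingleGPart (placedBlock eR eC) w h u := by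
  intro d
  obtain ⟨n₀, hfit⟩ := stub_blockFits d
  refine ⟨n₀ + 64, fun n hn h hh hdeg t e he ht ms hms hiso => ?_⟩
  classical
  set b := (Nat.log 2 n + d) ^ d with hb
  -- room for the placement off the cells `e i`: `2|K| + 2(b + b²) ≤ n`, `K = range e`
  set K : Finset (Fin n × Fin n) := Finset.univ.image e with hK
  have hKcard : K.card = t := by
    rw [hK, Finset.card_image_of_injective _ he, Finset.card_univ, Fintype.card_fin]
  have h8 : b + b * (b * 8) ≤ n := hfit n (by omega) 8 (by omega)
  have hN : 4 * (b + b * (b * 1)) ≤ n := le_trans (four_mul_block_le b) h8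
  have hroom : 2 * K.card + 2 * (b + b * (b * 1)) ≤ n := by omega
  obtain ⟨eR, eC, havoid⟩ := stub_keyPlacement b n K hroom
  set G := placedBlock eR eC with hG
  have heG : ∀ i, e i ∉ G := fun i hi =>
    havoid (e i) hi (Finset.mem_image_of_mem e (Finset.mem_univ i))
  -- the ordered cut
  obtain ⟨w, hcut, -, hlex⟩ :=
    stub_orderedCut b 1 (n - (b + b * (b * 1))) n t eR eC e h Nat.one_pos he heG hdeg
  -- its top fibre is `{ms}`
  have hfib : ∀ m₁ ∈ (topComponent w h).support, m₁ = ms := by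
    intro m₁ hm₁
    by_contra hne
    obtain ⟨i, hagree, hlt⟩ := hiso m₁ (support_topComponent_subset _ h hm₁) hne
    exact absurd (hlex m₁ hm₁ ms hms i hagree) (not_le.mpr hlt)
  -- conclusion: `u` is the `G`-part of `ms`
  refine ⟨b, 1, n - (b + b * (b * 1)), eR, eC, w, ms.filter (· ∈ G), le_rfl, hcut,
    fun f hf => ?_, fun m' hm' f hf => ?_⟩
  · rw [Finsupp.support_filter] at hf
    exact (Finset.mem_filter.mp hf).2
  · rw [hfib m' hm', Finsupp.filter_apply_pos _ _ hf]

end Summit.ValiantsHypothesis.ValiantsHypothesis.Theorems.DivisionGapPerDivisionHard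

end
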